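import Summits.SmoothPoincare4.SmoothPoincare4.Theorems.SblfDescentRungOneDefs
import Summits.SmoothPoincare4.SmoothPoincare4.Theorems.SblfDescentRungOneHelperF3Profiles
import Summits.SmoothPoincare4.SmoothPoincare4.Theorems.SblfDescentRungOneHelperF3PlaneAngle
import Literature.Topology.FourManifolds.GluckTwistFibre
import HarnessLib

/-!
# The Morse–Bott function and the angular map of brick F3: definitions (layer `f3fa_defs`)

Auxiliary file of stub `helper_f3_functionAlpha` (layer FA of the construction brick F3 =
`helper_sliceGluing_bottConstruction`: given the transported angular coordinate `a`, build the
Morse–Bott function `F` and the angular map `α` and verify the Morse–Bott datum `IsBottDatum`),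
line `Sketch`, crux `SblfDescent.RungOne`.

(Crux item stmt-SmoothPoincare4-18531; skeleton `Cruxes/RungOne/Lines/Sketch.lean`.)

This file only DECLARES the explicit model functions of the construction, all of them functions
on Euclidean spaces (the function on the manifold is `F x = modelF pm (f x) (a x)` and the angular
map is `α x = modelAlpha pm O (f x) (a x)`), together with the record `Params` of the numerical
parameters and of the proofs of their admissibility, and the record `Setting` collecting the
hypotheses of the layer on the manifold side (both records carry proofs, so that the later
layers take one argument each):

* `step a b` — the smooth monotone step from `a` to `b` (`Real.smoothTransition`); `mu pm`,
  `lam pm` — the two plateaus `μ` (from `-σ₂` to `-σ₁`) and `λ` (from `-σ₄` to `-σ₃`);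
* `affL pm t = P₁ - p₀ (t - 1/4)` — the affine lower part of the height profile `P`
  (`helper_f3_profile` with `c = 1`, `h₁ = 1/4`, `h₂ = 1/2`); `rho pm t = P t / √(1 - t²)`
  (`= 1` for `t ≥ 1/2`), smooth on `(-1, ∞)`;
* `phi pm t C = μ(t) ρ(t) C - (1 - μ(t)) L(t)` — the function in the variables
  (height, `C̃ = ⟪W, a⟫`); `hgt pm y = v₂ y₂` the height, `ctil pm y A = y₀ A₀ + σ y₁ A₁`
  the pairing of `W = (y₀, σ y₁)` with `A`; `modelF pm y A = phi (hgt y) (ctil y A)`;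
* `psiT pm q s = (μ(q) / √(1 + s²) - (1 - μ(q))) L(q)` — `F` read in the fold tube
  (`q = Q(y)`, `s = y₂`), which on `{μ = 1}` is the tube model of `helper_f3_tubeModel`;
* `cross v w = v₀ w₁ - v₁ w₀`; `quarterTurnL`, `planarL`, `conjSL` — the quarter turn
  `J (w₀, w₁) = (-w₁, w₀)` (`quarterTurn`, `rotPlane` are those of `GluckTwistFibre.lean`), the
  planar part `(y₀, y₁)` of `y ∈ ℝ³` and the conjugation `(A₀, σ A₁)` as continuous linear maps;
  `angLift u a` — the half-angle lift of the angle from `u` to `a` (`helper_f3_planeAngle`);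
  `unitDir y` — the longitude `(y₀, y₁)/‖(y₀, y₁)‖`;
* `modelAlpha pm O y A` — the angular map: `O⁻¹ (conjS σ A)` above height `-σ₃`, and the
  rotation of `ũ' = O⁻¹ (unitDir y)` by `λ(h) · angLift ũ' (O⁻¹ (conjS σ A))` below.

## References

* J. Milnor, *Morse theory*, Ann. of Math. Studies 51 (1963), §2–§3. [Milnor1963]
* R. İ. Baykur, S. Kamada, *Classification of broken Lefschetz fibrations with small fiber
  genera*, J. Math. Soc. Japan 67 (2015), §5. [BaykurKamada2015]
-/

set_option linter.dupNamespace false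

noncomputable section

open scoped Manifold ContDiff Topology RealInnerProductSpace
open Set Function Filter Literature.Topology.FourManifolds

namespace Summit.SmoothPoincare4.SmoothPoincare4.Cruxes.RungOne.Sketch

namespace F3fa

-- BEGIN BODY
/-! ### One-variable ingredients -/

/-- The smooth monotone step from `a` to `b`: `0` on `(-∞, a]`, `1` on `[b, ∞)`. [folklore] -/
def step (a b t : ℝ) : ℝ := Real.smoothTransition ((t - a) / (b - a))

/-- **The admissible parameters of the construction**: the height profile `P` with its lower
affine part `P₁ - p₀ (t - 1/4)` (a profile as produced by `helper_f3_profile 1 (1/4) (1/2) p₀`),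
the slope `0 < p₀ ≤ 1/5`, the plateau heights `0 < σ₁ < σ₂ < σ₃ < σ₄ < 1/8` (`μ` rises on
`[-σ₂, -σ₁]`, `λ` on `[-σ₄, -σ₃]`), the conjugation sign `σ = ±1` and the pole sign
`s = v₂ = ±1`, together with the proofs of their admissibility (auxiliary functions of one
variable as in Milnor 1963, §3). [cite: Milnor1963, §3] -/
structure Params where
  /-- the height profile -/
  P : ℝ → ℝ
  /-- the value `P (1/4)` -/
  P₁ : ℝ
  /-- the slope of the affine part -/
  p₀ : ℝ
  /-- `μ = 1` on `[-σ₁, ∞)` -/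
  σ₁ : ℝ
  /-- `μ = 0` on `(-∞, -σ₂]` -/
  σ₂ : ℝ
  /-- `λ = 1` on `[-σ₃, ∞)` -/
  σ₃ : ℝ
  /-- `λ = 0` on `(-∞, -σ₄]` -/
  σ₄ : ℝ
  /-- the conjugation sign -/
  σ : ℝ
  /-- the pole sign `v₂` -/
  s : ℝ
  σ₁_pos : 0 < σ₁
  σ₁_lt : σ₁ < σ₂
  σ₂_lt : σ₂ < σ₃
  σ₃_lt : σ₃ < σ₄
  σ₄_lt : σ₄ < 1 / 8
  σ_cases : σ = 1 ∨ σ = -1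
  s_cases : s = 1 ∨ s = -1
  p₀_pos : 0 < p₀
  p₀_le : p₀ ≤ 1 / 5
  continuous_P : Continuous P
  contDiffOn_P : ContDiffOn ℝ ∞ P (Set.Iio 1)
  P_top : ∀ t, 1 / 2 ≤ t → P t = 1 * √(1 - t ^ 2)
  P_bot : ∀ t, t ≤ 1 / 4 → P t = P₁ - p₀ * (t - 1 / 4)
  le_P₁ : 1 * √(1 - (1 / 4 : ℝ) ^ 2) ≤ P₁
  deriv_P_neg : ∀ t, t < 1 → deriv P t < 0
  P_pos : ∀ t, t < 1 → 0 < P t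
  strictAntiOn_P : StrictAntiOn P (Set.Iic 1)

/-- The plateau `μ`: from `0` at `-σ₂` to `1` at `-σ₁`. [folklore] -/
def mu (pm : Params) (t : ℝ) : ℝ := step (-pm.σ₂) (-pm.σ₁) t

/-- The plateau `λ`: from `0` at `-σ₄` to `1` at `-σ₃`. [folklore] -/
def lam (pm : Params) (t : ℝ) : ℝ := step (-pm.σ₄) (-pm.σ₃) t

/-- The affine lower part `L(t) = P₁ - p₀ (t - 1/4)` of the profile. [folklore] -/
def affL (pm : Params) (t : ℝ) : ℝ := pm.P₁ - pm.p₀ * (t - 1 / 4)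

/-- The reduced profile `ρ(t) = P(t) / √(1 - t²)`, continued by `1` above `3/4` (it equals `1`
on `[1/2, 1)` already), smooth on `(-1, ∞)`. [folklore] -/
def rho (pm : Params) (t : ℝ) : ℝ := if t < 3 / 4 then pm.P t / √(1 - t ^ 2) else 1

/-- The function of brick F3 in the variables (height `t`, pairing `C = ⟪W, a⟫`):
`φ(t, C) = μ(t) ρ(t) C - (1 - μ(t)) L(t)`. [folklore] -/
def phi (pm : Params) (t C : ℝ) : ℝ := mu pm t * rho pm t * C - (1 - mu pm t) * affL pm t

/-- The height `v₂ y₂` of a point `y` of the base sphere (`v = (0, 0, v₂)`). [folklore] -/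
def hgt (pm : Params) (y : EuclideanSpace ℝ (Fin 3)) : ℝ := pm.s * y 2

/-- The pairing `C̃ = ⟪W, A⟫ = y₀ A₀ + σ y₁ A₁` of `W = (y₀, σ y₁)` with `A`. [folklore] -/
def ctil (pm : Params) (y : EuclideanSpace ℝ (Fin 3)) (A : EuclideanSpace ℝ (Fin 2)) : ℝ :=
  y 0 * A 0 + pm.σ * y 1 * A 1

/-- **The model of the Morse–Bott function**: `F x = modelF pm (f x) (a x)`. [folklore] -/
def modelF (pm : Params) (y : EuclideanSpace ℝ (Fin 3)) (A : EuclideanSpace ℝ (Fin 2)) : ℝ :=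
  phi pm (hgt pm y) (ctil pm y A)

/-- The function read in the fold tube: `F (ν (u, y)) = psiT pm Q(y) y₂`,
`psiT q s = (μ(q) / √(1 + s²) - (1 - μ(q))) L(q)`. [folklore] -/
def psiT (pm : Params) (q s : ℝ) : ℝ := (mu pm q * (√(1 + s ^ 2))⁻¹ - (1 - mu pm q)) * affL pm q

/-! ### Plane ingredients -/

/-- The signed area `v₀ w₁ - v₁ w₀` (the sine of the angle from `v` to `w` for unit vectors).
[folklore] -/
def cross (v w : EuclideanSpace ℝ (Fin 2)) : ℝ := v 0 * w 1 - v 1 * w 0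

/-- The quarter turn `J (w₀, w₁) = (-w₁, w₀)` (`quarterTurn` of `GluckTwistFibre.lean`) as a
continuous linear map. [folklore] -/
def quarterTurnL : EuclideanSpace ℝ (Fin 2) →L[ℝ] EuclideanSpace ℝ (Fin 2) :=
  LinearMap.toContinuousLinearMap
    { toFun := quarterTurn
      map_add' := fun v w => by ext i; fin_cases i <;> simp [quarterTurn]; ring
      map_smul' := fun c v => by ext i; fin_cases i <;> simp [quarterTurn] }

/-- The half-angle lift `π - 2 arctan (s / (1 - c))` of the angle from `u` to `a`
(`c = u₀ a₀ + u₁ a₁`, `s = u₀ a₁ - u₁ a₀`), see `helper_f3_planeAngle`. [folklore] -/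
def angLift (u a : EuclideanSpace ℝ (Fin 2)) : ℝ :=
  Real.pi - 2 * Real.arctan ((u 0 * a 1 - u 1 * a 0) / (1 - (u 0 * a 0 + u 1 * a 1)))

/-- The conjugation `(A₀, A₁) ↦ (A₀, σ A₁)`. [folklore] -/
def conjS (σ : ℝ) (A : EuclideanSpace ℝ (Fin 2)) : EuclideanSpace ℝ (Fin 2) := !₂[A 0, σ * A 1]

/-- The planar part `(y₀, y₁)` of `y ∈ ℝ³`. [folklore] -/
def planar (y : EuclideanSpace ℝ (Fin 3)) : EuclideanSpace ℝ (Fin 2) := !₂[y 0, y 1]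

/-- The longitude `(y₀, y₁) / ‖(y₀, y₁)‖` of `y ∈ ℝ³` (junk `0` on the axis). [folklore] -/
def unitDir (y : EuclideanSpace ℝ (Fin 3)) : EuclideanSpace ℝ (Fin 2) :=
  (√(y 0 ^ 2 + y 1 ^ 2))⁻¹ • planar y

/-- The planar part as a continuous linear map. [folklore] -/
def planarL : EuclideanSpace ℝ (Fin 3) →L[ℝ] EuclideanSpace ℝ (Fin 2) :=
  LinearMap.toContinuousLinearMap
    { toFun := planar
      map_add' := fun v w => by ext i; fin_cases i <;> simp [planar]
      map_smul' := fun c v => by ext i; fin_cases i <;> simp [planar] }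

/-- The conjugation as a continuous linear map. [folklore] -/
def conjSL (σ : ℝ) : EuclideanSpace ℝ (Fin 2) →L[ℝ] EuclideanSpace ℝ (Fin 2) :=
  LinearMap.toContinuousLinearMap
    { toFun := conjS σ
      map_add' := fun v w => by ext i; fin_cases i <;> simp [conjS]; ring
      map_smul' := fun c v => by ext i; fin_cases i <;> simp [conjS]; ring }

/-- **The model of the angular map**: `α x = modelAlpha pm O (f x) (a x)`; above height `-σ₃`
it is `O⁻¹ (A₀, σ A₁)`, below it is the rotation of `ũ' = O⁻¹ (unitDir y)` by
`λ(h) · angLift ũ' (O⁻¹ (A₀, σ A₁))`. [folklore] -/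
def modelAlpha (pm : Params) (O : EuclideanSpace ℝ (Fin 2) ≃ₗᵢ[ℝ] EuclideanSpace ℝ (Fin 2))
    (y : EuclideanSpace ℝ (Fin 3)) (A : EuclideanSpace ℝ (Fin 2)) : EuclideanSpace ℝ (Fin 2) :=
  if -pm.σ₃ ≤ hgt pm y then O.symm (conjS pm.σ A)
  else rotPlane (lam pm (hgt pm y) * angLift (O.symm (unitDir y)) (O.symm (conjS pm.σ A)))
    (O.symm (unitDir y))

/-! ### Unfolding lemmas -/

/-- `quarterTurnL` acts as `quarterTurn`. [folklore] -/
@[simp] theorem quarterTurnL_apply (w : EuclideanSpace ℝ (Fin 2)) : quarterTurnL w = quarterTurn w := rfl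

/-- Coordinates of `quarterTurn`. [folklore] -/
@[simp] theorem quarterTurn_apply_zero (w : EuclideanSpace ℝ (Fin 2)) : quarterTurn w 0 = -w 1 := rfl

/-- Coordinates of `quarterTurn`. [folklore] -/
@[simp] theorem quarterTurn_apply_one (w : EuclideanSpace ℝ (Fin 2)) : quarterTurn w 1 = w 0 := rfl

/-- Coordinates of `conjS`. [folklore] -/
@[simp] theorem conjS_apply_zero (σ : ℝ) (A : EuclideanSpace ℝ (Fin 2)) : conjS σ A 0 = A 0 := rfl

/-- Coordinates of `conjS`. [folklore] -/
@[simp] theorem conjS_apply_one (σ : ℝ) (A : EuclideanSpace ℝ (Fin 2)) : conjS σ A 1 = σ * A 1 :=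
  rfl

/-- Coordinates of `planar`. [folklore] -/
@[simp] theorem planar_apply_zero (y : EuclideanSpace ℝ (Fin 3)) : planar y 0 = y 0 := rfl

/-- Coordinates of `planar`. [folklore] -/
@[simp] theorem planar_apply_one (y : EuclideanSpace ℝ (Fin 3)) : planar y 1 = y 1 := rfl

/-- Coordinates of `unitDir`. [folklore] -/
@[simp] theorem unitDir_apply_zero (y : EuclideanSpace ℝ (Fin 3)) :
    unitDir y 0 = (√(y 0 ^ 2 + y 1 ^ 2))⁻¹ * y 0 := by simp [unitDir]

/-- Coordinates of `unitDir`. [folklore] -/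
@[simp] theorem unitDir_apply_one (y : EuclideanSpace ℝ (Fin 3)) :
    unitDir y 1 = (√(y 0 ^ 2 + y 1 ^ 2))⁻¹ * y 1 := by simp [unitDir]

/-- `planarL` acts as `planar`. [folklore] -/
@[simp] theorem planarL_apply (y : EuclideanSpace ℝ (Fin 3)) : planarL y = planar y := rfl

/-- `conjSL` acts as `conjS`. [folklore] -/
@[simp] theorem conjSL_apply (σ : ℝ) (A : EuclideanSpace ℝ (Fin 2)) : conjSL σ A = conjS σ A := rfl

/-- The rotation by the angle lift takes the unit vector `u` to the unit vector `a ≠ u`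
(`rot_angleLift` of layer `f3_planeAngle`). [folklore] -/
theorem rotPlane_angLift {u a : EuclideanSpace ℝ (Fin 2)} (hu : ‖u‖ = 1) (ha : ‖a‖ = 1) (hne : a ≠ u) :
    rotPlane (angLift u a) u = a := rot_angleLift hu ha hne

/-- `modelF` unfolded. [folklore] -/
theorem modelF_eq (pm : Params) (y : EuclideanSpace ℝ (Fin 3)) (A : EuclideanSpace ℝ (Fin 2)) :
    modelF pm y A = mu pm (pm.s * y 2) * rho pm (pm.s * y 2) * (y 0 * A 0 + pm.σ * y 1 * A 1) -
      (1 - mu pm (pm.s * y 2)) * affL pm (pm.s * y 2) := rfl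

/-- `modelAlpha` above height `-σ₃`. [folklore] -/
theorem modelAlpha_of_le (pm : Params) (O : EuclideanSpace ℝ (Fin 2) ≃ₗᵢ[ℝ] EuclideanSpace ℝ (Fin 2))
    {y : EuclideanSpace ℝ (Fin 3)} (A : EuclideanSpace ℝ (Fin 2)) (h : -pm.σ₃ ≤ hgt pm y) :
    modelAlpha pm O y A = O.symm (conjS pm.σ A) := by simp [modelAlpha, h]

/-- `modelAlpha` below height `-σ₃`. [folklore] -/
theorem modelAlpha_of_lt (pm : Params) (O : EuclideanSpace ℝ (Fin 2) ≃ₗᵢ[ℝ] EuclideanSpace ℝ (Fin 2))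
    {y : EuclideanSpace ℝ (Fin 3)} (A : EuclideanSpace ℝ (Fin 2)) (h : hgt pm y < -pm.σ₃) :
    modelAlpha pm O y A = rotPlane (lam pm (hgt pm y) * angLift (O.symm (unitDir y)) (O.symm (conjS pm.σ A)))
      (O.symm (unitDir y)) := by simp [modelAlpha, not_le.2 h]

/-! ### The hypotheses on the manifold side -/

section Setting

variable {X : Type} [TopologicalSpace X] [ChartedSpace (EuclideanSpace ℝ (Fin 4)) X]

/-- **The hypotheses of layer FA of brick F3**, as a record: a smooth `f : X → S²` and a pole
`v = (0, 0, ±1)`, the `S¹`-parametric fold tube `ν` (`IsFoldTube`), the transported angular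
coordinate `a` (`IsTransportedAngle`), parameters `pm` carrying the signs of the data,
`σ₄ < σ₅`, `εT ≤ ε`, a Bott tube radius `εF` (`tube(εF)` inside the formula region and inside
`{μ = 1}`), and the GAP inequality `C̃ + 2 p₀ ≤ ‖W‖` on `{-σ₂ ≤ h ≤ 0}` off `tube(εF)` (obtained in the
assembly from compactness and the level property, before the slope `p₀` is chosen).
[cite: BaykurKamada2015, §5] -/
structure Setting (f : X → Metric.sphere (0 : EuclideanSpace ℝ (Fin 3)) 1)
    (v : Metric.sphere (0 : EuclideanSpace ℝ (Fin 3)) 1) (ε : ℝ)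
    (ν : (Metric.sphere (0 : EuclideanSpace ℝ (Fin 2)) 1) × EuclideanSpace ℝ (Fin 3) → X)
    (σ sA sB ε₂ : ℝ) (A : X → Metric.sphere (0 : EuclideanSpace ℝ (Fin 2)) 1) (σ₀ σ₅ εT β : ℝ)
    (a : X → Metric.sphere (0 : EuclideanSpace ℝ (Fin 2)) 1) (pm : Params) (εF : ℝ) : Type where
  contMDiff_f : ContMDiff (𝓡 4) (𝓡 2) ∞ f
  v_zero : (v : EuclideanSpace ℝ (Fin 3)) 0 = 0
  v_one : (v : EuclideanSpace ℝ (Fin 3)) 1 = 0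
  tube : IsFoldTube f v ε ν
  angle : IsTransportedAngle f v ν σ sA sB ε₂ A σ₀ σ₅ εT β a
  σ_eq : pm.σ = σ
  s_eq : pm.s = (v : EuclideanSpace ℝ (Fin 3)) 2
  σ₄_lt : pm.σ₄ < σ₅
  εT_sq_lt : εT ^ 2 < 1 / 4
  εF_pos : 0 < εF
  εF_le_εT : εF ≤ εT
  εF_le_ε : εF ≤ ε
  εT_le_ε : εT ≤ ε
  εF_sq_lt : εF ^ 2 < β
  εF_sq_le : εF ^ 2 ≤ pm.σ₁
  gap : ∀ x : X, -pm.σ₂ ≤ hgt pm (f x) → hgt pm (f x) ≤ 0 →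
    x ∉ ν '' ((Set.univ : Set (Metric.sphere (0 : EuclideanSpace ℝ (Fin 2)) 1)) ×ˢ
      Metric.ball (0 : EuclideanSpace ℝ (Fin 3)) εF) →
    ctil pm (f x) (a x) + 2 * pm.p₀ ≤ √(((f x : Metric.sphere (0 : EuclideanSpace ℝ (Fin 3)) 1) : EuclideanSpace ℝ (Fin 3)) 0 ^ 2 + ((f x : Metric.sphere (0 : EuclideanSpace ℝ (Fin 3)) 1) : EuclideanSpace ℝ (Fin 3)) 1 ^ 2)

end Setting

/-- **Layer `f3fa_defs` of stub `helper_f3_functionAlpha`: the model functions unfold as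
designed** — the function is `μ(h) ρ(h) C̃ - (1 - μ(h)) L(h)` in the height `h = v₂ y₂` and the
pairing `C̃ = y₀ A₀ + σ y₁ A₁`, the angular map is `O⁻¹ (A₀, σ A₁)` above height `-σ₃`, rotations
are isometries and the rotation by the angle lift takes `u` to `a` (Milnor 1963, §3: auxiliary
functions). [cite: Milnor1963, §3] -/
theorem helper_f3fa_defs : (∀ (pm : Params) (y : EuclideanSpace ℝ (Fin 3)) (A : EuclideanSpace ℝ (Fin 2)), modelF pm y A = mu pm (pm.s * y 2) * rho pm (pm.s * y 2) * (y 0 * A 0 + pm.σ * y 1 * A 1) - (1 - mu pm (pm.s * y 2)) * affL pm (pm.s * y 2)) ∧ (∀ (pm : Params) (O : EuclideanSpace ℝ (Fin 2) ≃ₗᵢ[ℝ] EuclideanSpace ℝ (Fin 2)) (y : EuclideanSpace ℝ (Fin 3)) (A : EuclideanSpace ℝ (Fin 2)), -pm.σ₃ ≤ pm.s * y 2 → modelAlpha pm O y A = O.symm (conjS pm.σ A)) ∧ (∀ (θ : ℝ) (w : EuclideanSpace ℝ (Fin 2)), ‖rotPlane θ w‖ = ‖w‖) ∧ (∀ (u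 a : EuclideanSpace ℝ (Fin 2)), ‖u‖ = 1 → ‖a‖ = 1 → a ≠ u → rotPlane (angLift u a) u = a) :=
  ⟨modelF_eq, fun pm O _ A h => modelAlpha_of_le pm O A h, norm_rotPlane, fun _ _ hu ha hne =>
    rotPlane_angLift hu ha hne⟩

-- END BODY
end F3fa

end Summit.SmoothPoincare4.SmoothPoincare4.Cruxes.RungOne.Sketch

end
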